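import Summits.CriticalPhenomena.SAWScalingLimit.Theorems.SAWLoopFugacityFlowAvoidancePassageExcursions
import Literature.Topology.PlaneTopology.Schoenflies

/-!
# Every point of `D ∖ cl D'` lies in a bite

Support file for item `stmt-CriticalPhenomena-4984` (`AvoidancePassage`). For Jordan domains
`D' ⊆ D` with two points of `∂D'` outside `D`:

* `isPreconnected_ball_diff_closedBall` — for `|ζ| = 1` and `0 < κ ≤ ½` the set
  `B(ζ, κ) ∖ 𝔻̄` is (star-convex, hence) preconnected;
* `exists_open_nhds_preconnected_diff_closure` — **local connectedness of the exterior of a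
  Jordan domain along its boundary**, from the Schoenflies theorem of the tree
  (`JordanDomain.DiscChart.exists_homeomorph_eqOn`): every `q ∈ ∂D'` has arbitrarily small open
  neighbourhoods `N` with `N ∖ cl D'` preconnected;
* `exists_excursion_of_not_mem_closure` — **every `z ∈ D ∖ cl D'` lies in the bite of some
  excursion**: the component of `z` in `D ∖ cl D'` has a frontier point `q ∈ D ∩ ∂D'`; for the
  excursion through `q`, local connectedness at `q` puts that component on the bite side.

All folklore; no new definitions.
-/

noncomputable section

namespace Summit.CriticalPhenomena.SAWScalingLimit.Theorems.AvoidancePassage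

open Set Metric Filter Topology
open Literature.Topology.PlaneTopology
open Literature.Probability.RandomPlanarGeometry (JordanDomain)

/-! ### A ball about a point of the unit circle, minus the closed disc, is connected -/

/-- For `0 < κ ≤ ½`, the set `B(1, κ) ∖ 𝔻̄` is star-convex with respect to `1 + κ/2`: for `w` in
it, `re w > 1 - κ²/2`, which keeps the segment to `1 + κ/2` outside the closed unit disc.
[folklore] -/
theorem starConvex_ball_one_inter_compl {κ : ℝ} (hκ : 0 < κ) (hκ' : κ ≤ 1 / 2) :
    StarConvex ℝ (((1 + κ / 2 : ℝ) : ℂ)) (ball (1 : ℂ) κ \ closedBall (0 : ℂ) 1) := by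
  have hc : ((1 + κ / 2 : ℝ) : ℂ) ∈ ball (1 : ℂ) κ := by
    rw [mem_ball, dist_eq_norm, show ((1 + κ / 2 : ℝ) : ℂ) - 1 = ((κ / 2 : ℝ) : ℂ) by
      push_cast; ring, Complex.norm_real, Real.norm_eq_abs, abs_of_pos (by positivity)]
    linarith
  intro w hw a b ha hb hab
  obtain ⟨hw1, hw2⟩ := hw
  refine ⟨convex_ball (1 : ℂ) κ hc hw1 ha hb hab, ?_⟩
  rw [mem_closedBall, dist_zero_right, not_le] at hw2 ⊢
  -- coordinates
  set x := w.re with hx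
  set y := w.im with hy
  have h1 : (x - 1) ^ 2 + y ^ 2 < κ ^ 2 := by
    have h := hw1
    rw [mem_ball, dist_eq_norm] at h
    have h' : ‖w - 1‖ ^ 2 < κ ^ 2 := pow_lt_pow_left₀ h (norm_nonneg _) two_ne_zero
    rw [Complex.sq_norm, Complex.normSq_apply] at h'
    simpa [hx, hy, pow_two] using h'
  have h2 : 1 < x ^ 2 + y ^ 2 := by
    have h' : (1 : ℝ) ^ 2 < ‖w‖ ^ 2 := pow_lt_pow_left₀ hw2 zero_le_one two_ne_zero
    rw [one_pow, Complex.sq_norm, Complex.normSq_apply] at h'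
    simpa [hx, hy, pow_two] using h'
  have hxlow : 1 - κ ^ 2 / 2 < x := by nlinarith
  set c : ℝ := 1 + κ / 2 with hc_def
  have hcx : 1 ≤ c * x := by
    have : c * (1 - κ ^ 2 / 2) ≤ c * x := mul_le_mul_of_nonneg_left hxlow.le (by positivity)
    nlinarith
  -- the point of the segment
  have hre : (a • ((c : ℝ) : ℂ) + b • w).re = a * c + b * x := by simp [hx]
  have him : (a • ((c : ℝ) : ℂ) + b • w).im = b * y := by simp [hy]
  apply lt_of_pow_lt_pow_left₀ 2 (norm_nonneg _)
  rw [one_pow, Complex.sq_norm, Complex.normSq_apply, hre, him]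
  rcases hb.eq_or_lt with rfl | hb'
  · have ha1 : a = 1 := by linarith
    subst ha1
    nlinarith
  · have hb2 : 0 < b ^ 2 := by positivity
    have hc1 : (1 : ℝ) ≤ c ^ 2 := by rw [hc_def]; nlinarith
    have e1 : b ^ 2 * 1 < b ^ 2 * (x ^ 2 + y ^ 2) := mul_lt_mul_of_pos_left h2 hb2
    have e2 : a ^ 2 * 1 ≤ a ^ 2 * c ^ 2 := mul_le_mul_of_nonneg_left hc1 (sq_nonneg a)
    have e3 : 2 * a * b * 1 ≤ 2 * a * b * (c * x) :=
      mul_le_mul_of_nonneg_left hcx (by positivity)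
    have hab' : a = 1 - b := by linarith
    calc (1 : ℝ) = a ^ 2 * 1 + 2 * a * b * 1 + b ^ 2 * 1 := by rw [hab']; ring
      _ < a ^ 2 * c ^ 2 + 2 * a * b * (c * x) + b ^ 2 * (x ^ 2 + y ^ 2) :=
          add_lt_add_of_le_of_lt (add_le_add e2 e3) e1
      _ = (a * c + b * x) * (a * c + b * x) + b * y * (b * y) := by ring

/-- Rotating by a unit complex number: `B(ζ, κ) ∖ 𝔻̄ = ζ · (B(1, κ) ∖ 𝔻̄)`. [folklore] -/
theorem ball_diff_closedBall_eq_image {ζ : ℂ} (hζ : ‖ζ‖ = 1) (κ : ℝ) :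
    ball ζ κ \ closedBall (0 : ℂ) 1 = (fun z ↦ ζ * z) '' (ball (1 : ℂ) κ \ closedBall 0 1) := by
  have hζ0 : ζ ≠ 0 := fun h ↦ by simp [h] at hζ
  ext z
  simp only [Set.mem_sdiff, mem_ball, mem_closedBall, dist_eq_norm, not_le, mem_image, sub_zero]
  constructor
  · rintro ⟨h1, h2⟩
    refine ⟨ζ⁻¹ * z, ⟨?_, ?_⟩, by field_simp⟩
    · have : ζ⁻¹ * z - 1 = ζ⁻¹ * (z - ζ) := by field_simp
      rw [this, norm_mul, norm_inv, hζ, inv_one, one_mul]; exact h1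
    · rw [norm_mul, norm_inv, hζ, inv_one, one_mul]; exact h2
  · rintro ⟨w, ⟨h1, h2⟩, rfl⟩
    refine ⟨?_, ?_⟩
    · have : ζ * w - ζ = ζ * (w - 1) := by ring
      rw [this, norm_mul, hζ, one_mul]; exact h1
    · rw [norm_mul, hζ, one_mul]; exact h2

/-- **`B(ζ, κ) ∖ 𝔻̄` is preconnected** for `|ζ| = 1`, `0 < κ ≤ ½`. [folklore] -/
theorem isPreconnected_ball_diff_closedBall {ζ : ℂ} (hζ : ‖ζ‖ = 1) {κ : ℝ} (hκ : 0 < κ)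
    (hκ' : κ ≤ 1 / 2) : IsPreconnected (ball ζ κ \ closedBall (0 : ℂ) 1) := by
  rw [ball_diff_closedBall_eq_image hζ]
  refine IsPreconnected.image ?_ _ (by fun_prop)
  have hmem : ((1 + κ / 2 : ℝ) : ℂ) ∈ ball (1 : ℂ) κ \ closedBall (0 : ℂ) 1 := by
    constructor
    · rw [mem_ball, dist_eq_norm, show ((1 + κ / 2 : ℝ) : ℂ) - 1 = ((κ / 2 : ℝ) : ℂ) by
        push_cast; ring, Complex.norm_real, Real.norm_eq_abs, abs_of_pos (by positivity)]
      linarith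
    · rw [mem_closedBall, dist_zero_right, Complex.norm_real, Real.norm_eq_abs,
        abs_of_pos (by positivity), not_le]
      linarith
  exact ((starConvex_ball_one_inter_compl hκ hκ').isPathConnected hmem).isConnected.isPreconnected

/-! ### Local connectedness of the exterior along the boundary (Schoenflies) -/

/-- **The exterior of a Jordan domain is locally connected along the boundary curve.** Every
point `q ∈ ∂D'` has arbitrarily small open neighbourhoods `N` such that `N ∖ cl D'` is
preconnected (images of small balls under a Schoenflies homeomorphism `ℂ ≃ₜ ℂ` carrying the unit
disc onto `D'`, `JordanDomain.DiscChart.exists_homeomorph_eqOn`).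
[cite: PommerenkeBBCM1992, §2.3 Cor. 2.8 (p. 25)] -/
theorem exists_open_nhds_preconnected_diff_closure (D' : JordanDomain) {q : ℂ}
    (hq : q ∈ frontier D'.carrier) {U : Set ℂ} (hU : U ∈ 𝓝 q) :
    ∃ N : Set ℂ, IsOpen N ∧ q ∈ N ∧ N ⊆ U ∧ IsPreconnected (N \ closure D'.carrier) := by
  obtain ⟨z₀, hz₀⟩ := D'.nonempty
  obtain ⟨C, -⟩ := D'.exists_discChart_apply_eq hz₀
  obtain ⟨H, -, -, hsph, hcl, -⟩ := C.exists_homeomorph_eqOn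
  -- `q = H ζ` with `|ζ| = 1`
  have hq' : q ∈ H '' sphere 0 1 := hsph ▸ hq
  obtain ⟨ζ, hζ, rfl⟩ := hq'
  rw [mem_sphere_zero_iff_norm] at hζ
  -- a small ball about `ζ` mapped into `U`
  have hU' : H ⁻¹' U ∈ 𝓝 ζ := H.continuous.continuousAt.preimage_mem_nhds hU
  obtain ⟨κ₀, hκ₀, hball⟩ := Metric.mem_nhds_iff.1 hU'
  set κ := min κ₀ (1 / 2) with hκ
  have hκpos : 0 < κ := lt_min hκ₀ (by norm_num)
  refine ⟨H '' ball ζ κ, H.isOpenMap _ isOpen_ball, ⟨ζ, mem_ball_self hκpos, rfl⟩, ?_, ?_⟩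
  · rintro _ ⟨w, hw, rfl⟩
    exact hball (ball_subset_ball (min_le_left _ _) hw)
  · rw [← hcl, ← image_sdiff H.injective]
    exact (isPreconnected_ball_diff_closedBall hζ hκpos (min_le_right _ _)).image _
      H.continuous.continuousOn

/-! ### Every point outside `cl D'` lies in a bite -/

/-- A component of the open set `D ∖ cl D'` (with `∅ ≠ D' ⊆ D`, `D` connected) has a frontier point
inside `D`; such a point lies on `∂D'`. [folklore] -/
theorem exists_mem_frontier_component (D D' : JordanDomain) (hsub : D'.carrier ⊆ D.carrier) {z : ℂ}
    (hzD : z ∈ D.carrier) (hz : z ∉ closure D'.carrier) :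
    ∃ q, q ∈ frontier (connectedComponentIn (D.carrier \ closure D'.carrier) z) ∧ q ∈ D.carrier ∧
      q ∈ frontier D'.carrier := by
  set O := D.carrier \ closure D'.carrier with hO
  set C := connectedComponentIn O z with hC
  have hOo : IsOpen O := D.isOpen.sdiff isClosed_closure
  have hzO : z ∈ O := ⟨hzD, hz⟩
  have hCo : IsOpen C := hOo.connectedComponentIn
  have hCO : C ⊆ O := connectedComponentIn_subset _ _
  have hzC : z ∈ C := mem_connectedComponentIn hzO
  have hD'C : Disjoint D'.carrier (closure C) := by
    refine Disjoint.closure_right ?_ D'.isOpen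
    exact Set.disjoint_left.2 fun w hw hwC ↦ (hCO hwC).2 (subset_closure hw)
  -- a frontier point of `C` inside `D`
  have hex : ∃ q ∈ frontier C, q ∈ D.carrier := by
    by_contra h
    push Not at h
    have hcover : D.carrier ⊆ C ∪ (closure C)ᶜ := by
      intro w hw
      by_cases hwc : w ∈ closure C
      · rw [closure_eq_self_union_frontier] at hwc
        rcases hwc with hwc | hwc
        · exact Or.inl hwc
        · exact absurd hw (h w hwc)
      · exact Or.inr hwc
    obtain ⟨p, hp⟩ := D'.nonempty
    have hne := D.isConnected.isPreconnected C (closure C)ᶜ hCo isClosed_closure.isOpen_compl hcover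
      ⟨z, hzD, hzC⟩ ⟨p, hsub hp, fun hpc ↦ Set.disjoint_left.1 hD'C hp hpc⟩
    obtain ⟨w, -, hwC, hwc⟩ := hne
    exact hwc (subset_closure hwC)
  obtain ⟨q, hqC, hqD⟩ := hex
  refine ⟨q, hqC, hqD, ?_⟩
  have hqC' : q ∉ C := fun h ↦ by
    have h' : q ∈ C ∩ frontier C := ⟨h, hqC⟩
    rw [hCo.inter_frontier_eq] at h'
    exact h'
  have hqO : q ∉ O := by
    intro hqO
    have hq' : connectedComponentIn O q ∈ 𝓝 q :=
      hOo.connectedComponentIn.mem_nhds (mem_connectedComponentIn hqO)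
    obtain ⟨w, hwq, hwC⟩ := mem_closure_iff_nhds.1 (frontier_subset_closure hqC) _ hq'
    have heq : connectedComponentIn O z = connectedComponentIn O w := connectedComponentIn_eq hwC
    have heq' : connectedComponentIn O q = connectedComponentIn O w := connectedComponentIn_eq hwq
    exact hqC' (by rw [show C = connectedComponentIn O z from rfl, heq, ← heq']
                   exact mem_connectedComponentIn hqO)
  have hqcl : q ∈ closure D'.carrier := by
    by_contra h'
    exact hqO ⟨hqD, h'⟩
  rw [D'.isOpen.frontier_eq]
  exact ⟨hqcl, fun hqD' ↦ Set.disjoint_left.1 hD'C hqD' (frontier_subset_closure hqC)⟩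

/-- **Every point of `D ∖ cl D'` lies in a bite.** Let `D' ⊆ D` be Jordan domains with two
distinct points of `∂D'` outside `D`, and `z ∈ D ∖ cl D'`. Then there is an excursion
`(u₀, u₁)` of `∂D'` inside `D` such that `z` lies on the bite side of its arc
`e = D'.boundary '' [u₀, u₁]`: for every splitting `D ∖ e = B ⊔ W` into open sets with `D' ⊆ W`
and `e ⊆ ∂B`, `z ∈ B`. [folklore] -/
theorem exists_excursion_of_not_mem_closure (D D' : JordanDomain) (hsub : D'.carrier ⊆ D.carrier)
    {p₁ p₂ : ℂ} (hp₁ : p₁ ∈ frontier D'.carrier) (hp₂ : p₂ ∈ frontier D'.carrier) (hp : p₁ ≠ p₂)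
    (hp₁D : p₁ ∉ D.carrier) (hp₂D : p₂ ∉ D.carrier) {z : ℂ} (hzD : z ∈ D.carrier)
    (hz : z ∉ closure D'.carrier) :
    ∃ u₀ u₁ : ℝ, u₀ < u₁ ∧ u₁ < u₀ + 1 ∧ (∀ t ∈ Ioo u₀ u₁, D'.boundary t ∈ D.carrier) ∧
      D'.boundary u₀ ∉ D.carrier ∧ D'.boundary u₁ ∉ D.carrier ∧
      ∀ B W : Set ℂ, IsOpen B → IsOpen W → Disjoint B W →
        B ∪ W = D.carrier \ D'.boundary '' Icc u₀ u₁ → D'.carrier ⊆ W →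
        D'.boundary '' Icc u₀ u₁ ⊆ frontier B → z ∈ B := by
  set O := D.carrier \ closure D'.carrier with hO
  set C := connectedComponentIn O z with hC
  have hzO : z ∈ O := ⟨hzD, hz⟩
  have hCO : C ⊆ O := connectedComponentIn_subset _ _
  have hzC : z ∈ C := mem_connectedComponentIn hzO
  have hCc : IsPreconnected C := isPreconnected_connectedComponentIn
  obtain ⟨q, hqC, hqD, hqD'⟩ := exists_mem_frontier_component D D' hsub hzD hz
  -- the excursion through `q`
  have hq' : q ∈ range D'.boundary := D'.range_boundary ▸ hqD'
  obtain ⟨u, rfl⟩ := hq'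
  obtain ⟨u₀, u₁, hu₀, hu₁, hlen, hin, h₀, h₁⟩ := exists_excursion D D' hqD hp₁ hp₂ hp hp₁D hp₂D
  refine ⟨u₀, u₁, hu₀.trans hu₁, hlen, hin, h₀, h₁, fun B W hBo hWo hdisj hunion hD'W heB ↦ ?_⟩
  set e := D'.boundary '' Icc u₀ u₁ with he
  have hecl : e ⊆ closure D'.carrier := fun w hw ↦
    frontier_subset_closure (image_Icc_subset_frontier D' hw)
  have hOsub : O ⊆ D.carrier \ e := fun w hw ↦ ⟨hw.1, fun hwe ↦ hw.2 (hecl hwe)⟩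
  have hqe : D'.boundary u ∈ e := ⟨u, ⟨hu₀.le, hu₁.le⟩, rfl⟩
  -- local connectedness at `q`
  obtain ⟨N, hNo, hqN, hND, hP⟩ :=
    exists_open_nhds_preconnected_diff_closure D' hqD' (D.isOpen.mem_nhds hqD)
  set P := N \ closure D'.carrier with hPdef
  have hPO : P ⊆ O := fun w hw ↦ ⟨hND hw.1, hw.2⟩
  -- `P` meets `C` and `B`
  obtain ⟨w, hwN, hwC⟩ := mem_closure_iff_nhds.1 (frontier_subset_closure hqC) N (hNo.mem_nhds hqN)
  have hwP : w ∈ P := ⟨hwN, (hCO hwC).2⟩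
  obtain ⟨w', hw'N, hw'B⟩ :=
    mem_closure_iff_nhds.1 (frontier_subset_closure (heB hqe)) N (hNo.mem_nhds hqN)
  have hw'P : w' ∈ P :=
    ⟨hw'N, fun h ↦ Set.disjoint_left.1 (disjoint_closure_of_subset_side hBo hdisj hD'W) hw'B h⟩
  -- `P ∪ C` is preconnected, lies in `D ∖ e`, meets `B`: it lies in `B`
  have hQ : IsPreconnected (P ∪ C) := IsPreconnected.union w hwP hwC hP hCc
  have hQsub : P ∪ C ⊆ D.carrier \ e := union_subset (hPO.trans hOsub) (hCO.trans hOsub)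
  rcases hQ.subset_or_subset hBo hWo hdisj (hunion.symm ▸ hQsub) with h | h
  · exact h (Or.inr hzC)
  · exact absurd (h (Or.inl hw'P)) (Set.disjoint_left.1 hdisj hw'B)

end Summit.CriticalPhenomena.SAWScalingLimit.Theorems.AvoidancePassage

end
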